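import Summits.NavierStokesRegularity.FluidComputer.GateBudget
import HarnessLib

/-!
# GateBudget part 96 — the √P pair ledger: the square-root slip and its summation (§270–§271)

Cell `pub-fluidc`, blueprint seat bp1 (gen 38, SPEC-INPUT-bp1 §BP(4)(a)/(7b), §BT(3): "the √P
ledger is the next and only lever on the sufficiency side"); namespace
`Summit.NavierStokesRegularity.FluidComputer.GateBudget`. PURE ALGEBRA over the reals — no
trajectory: the bookkeeping that part 97 runs along part 94's balanced ladder. HONEST FRAMING:
a low prior, high value-of-information experiment on Tao's machine paradigm; NOT a claim that
NS blows up.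

WHAT. Parts 82/85/88/94 charge the pair `P = d² + ã²` per clean rung the LINEAR slip `S ≥
(0.2829 + u)u + (2D + ι)ι + 6(D + ι + 3/K⁹)/K⁹` (`u = U/K⁹` the pulse gain of the output, part
82 §239 `pulse_pslip`: `(ã + u)² - ã² ≤ (2·0.1415 + u)u` because `ã ≤ √(1/50)`), so the budget
`P ≤ 1/50` lasts `N - 1 ≤ 0.0199K⁹/(1.1 + k²/10)` rungs (part 95). But the output is SMALL early
on: `ã(rₙ) ≤ √P(rₙ)`, and `2ã·u` summed along the ladder is quadratic, not linear, in `n`.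
§270 is that ledger in the square-root coordinate: `pulse_pslip_sqrt` — `d'² + ã'² ≤ (√(d² +
ã²) + u)² + (2D + ι)ι` (part 82 §239 with `2ã ≤ 2√P` in place of `2ã ≤ 0.2829`);
`sqrt_sq_add_le_half` — `√(x² + δ) ≤ x + δ/(2x)`; `log_succ_step` — `c/(m + 1) ≤ c(log(m + 1) - log
m)`; `sqrt_ledger_step` — if `(m + 1)/Q ≤ x` and `P' ≤ x² + δ` then `√P' ≤ x + (δQ/2)(log(m +
1) - log m)`: the ã-free part `δ` of the slip enters `√P` only as `δ/(2√P)`, and since the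
output floor gives `√P(rₙ) + u ≥ (n + 1)/K⁹` it sums to `(δK⁹/2)·log N` — so along the ladder
`√P(rₙ) ≤ √P₁ + (n - 1)u + (δK⁹/2) log n` (part 97); `pair_window_mono`, `sqrt_pair_cap`,
`output_le_sqrt_pair` are the monotone bookkeeping. §271 `pair_ledger_numerics` are the
lattice numbers for part 98 (`K ≥ 16`, `1 ≤ k ≤ K²`, part 86's ledgers `D = 7/K⁴`, `U = 7/2 +
k²/3 + 10⁻³`): `δK⁹/2 ≤ (14k + 127)/(5K⁴)` and `(7/K⁴ + 0.1409)² + 10⁻⁴ + (1.1 + k²/10)/K⁹ ≤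
1/50`; `pair_window_coarse_sqrt`: the √-window implies `N - 1 ≤ K⁹`.
NUMBERS (forecast of part 98, `K = 16`, `k = 1`): window `(N - 1)·3.834/K⁹ + (141/(5K⁴)) log N
≤ 0.1409` ⇒ `N - 1 ≤ 0.0343K⁹ = 2.36·10⁹` clean rungs (part 95: `0.01658K⁹`, ×2.07; `K → ∞`:
`0.03675K⁹`, ×2.2), a factor `≈ 4` below part 72's forced ceiling `0.1415K⁹ + 1` — that
factor is now the pulse gain `u ≈ 3.83/K⁹` per rung against the injection floor `1/K⁹`.
HOW. `Real.sqrt_le_sqrt`, `Real.sqrt_sq`, `Real.sq_sqrt`, `Real.log_le_sub_one_of_pos` (for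
`log(m/(m + 1)) ≤ -1/(m + 1)`), `Real.log_le_log`, `pow_le_pow_left₀`, `div_le_div_of_nonneg_left`,
`field_simp`/`ring` identities, `linarith`/`nlinarith`/`positivity`.
HONEST LIMITS. (i) algebra only — the trajectory ladder is part 97, the horizon part 98; (ii)
the log term is wasteful by design (`√P + u ≥ (n + 1)/K⁹` discards `√P₁` and most of `u`);
(iii) the pulse gain `U` (part 82 §239) is untouched and is the next lever; (iv) nothing about
Navier–Stokes.
[cite: Tao2016AveragedNS, §5.5 Theorem 5.3, (5.5), (5.6), (d-eq), (ta-eq), (est)]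
-/

noncomputable section

namespace Summit.NavierStokesRegularity.FluidComputer.GateBudget

open Real Set

variable {K : ℝ}

/-! ## §270 The square-root slip and the ledger step -/

/-- §270 THE OUTPUT IS BELOW THE PAIR RADIUS: `0 ≤ a` ⇒ `a ≤ √(d² + a²)`. [folklore] -/
theorem output_le_sqrt_pair {a d : ℝ} (ha : 0 ≤ a) : a ≤ √(d ^ 2 + a ^ 2) := by
  have h := Real.sqrt_le_sqrt (show a ^ 2 ≤ d ^ 2 + a ^ 2 by nlinarith [sq_nonneg d])
  rwa [Real.sqrt_sq ha] at h

/-- §270 THE SQUARE-ROOT PULSE SLIP (reals): `0 ≤ a ≤ a' ≤ a + u`, `|d'| ≤ |d| + ι`, `|d| ≤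
D`, `0 ≤ ι` ⇒ `d'² + a'² ≤ (√(d² + a²) + u)² + (2D + ι)ι` — part 82 §239 `pulse_pslip` with
`2a ≤ 2√(d² + a²)` in place of `2a ≤ 0.2829`. [derived: part 82 §239] -/
theorem pulse_pslip_sqrt {a a' d d' u D ι : ℝ} (ha : 0 ≤ a) (ha' : a' ≤ a + u) (haa' : a ≤ a')
    (hd' : |d'| ≤ |d| + ι) (hD : |d| ≤ D) (hι : 0 ≤ ι) :
    d' ^ 2 + a' ^ 2 ≤ (√(d ^ 2 + a ^ 2) + u) ^ 2 + (2 * D + ι) * ι := by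
  have hu : 0 ≤ u := by linarith
  have hs2 : √(d ^ 2 + a ^ 2) ^ 2 = d ^ 2 + a ^ 2 := Real.sq_sqrt (by positivity)
  have has : a ≤ √(d ^ 2 + a ^ 2) := output_le_sqrt_pair ha
  have hA : a' ^ 2 ≤ (a + u) ^ 2 := pow_le_pow_left₀ (ha.trans haa') ha' 2
  have hB : |d'| ^ 2 ≤ (|d| + ι) ^ 2 := pow_le_pow_left₀ (abs_nonneg _) hd' 2
  rw [sq_abs] at hB
  have h1 : 2 * a * u ≤ 2 * √(d ^ 2 + a ^ 2) * u :=
    mul_le_mul_of_nonneg_right (by linarith) hu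
  have h2 : 2 * |d| * ι ≤ 2 * D * ι := mul_le_mul_of_nonneg_right (by linarith) hι
  linarith [hA, hB, h1, h2, sq_abs d, hs2]

/-- §270 THE SQUARE-ROOT STEP: `0 < x`, `0 ≤ δ` ⇒ `√(x² + δ) ≤ x + δ/(2x)` (concavity of `√`).
[folklore] -/
theorem sqrt_sq_add_le_half {x δ : ℝ} (hx : 0 < x) (hδ : 0 ≤ δ) :
    √(x ^ 2 + δ) ≤ x + δ / (2 * x) := by
  have hy : 0 ≤ x + δ / (2 * x) := by positivity
  have e : (x + δ / (2 * x)) ^ 2 = x ^ 2 + δ + (δ / (2 * x)) ^ 2 := by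
    field_simp
    ring
  have h : x ^ 2 + δ ≤ (x + δ / (2 * x)) ^ 2 := by
    rw [e]; linarith [sq_nonneg (δ / (2 * x))]
  calc √(x ^ 2 + δ) ≤ √((x + δ / (2 * x)) ^ 2) := Real.sqrt_le_sqrt h
    _ = x + δ / (2 * x) := Real.sqrt_sq hy

/-- §270 THE LOGARITHMIC STEP: `1 ≤ m`, `0 ≤ c` ⇒ `c/(m + 1) ≤ c·(log(m + 1) - log m)` (from
`log(m/(m + 1)) ≤ m/(m + 1) - 1`). [folklore] -/
theorem log_succ_step {m c : ℝ} (hm : 1 ≤ m) (hc : 0 ≤ c) :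
    c / (m + 1) ≤ c * (log (m + 1) - log m) := by
  have hm0 : 0 < m := by linarith
  have hm1 : 0 < m + 1 := by linarith
  have h1 := Real.log_le_sub_one_of_pos (div_pos hm0 hm1)
  rw [Real.log_div hm0.ne' hm1.ne'] at h1
  have e : m / (m + 1) - 1 = -(1 / (m + 1)) := by
    field_simp
    ring
  have h : 1 / (m + 1) ≤ log (m + 1) - log m := by linarith [h1, e]
  calc c / (m + 1) = c * (1 / (m + 1)) := by ring
    _ ≤ c * (log (m + 1) - log m) := mul_le_mul_of_nonneg_left h hc

/-- §270 **THE LEDGER STEP** (reals, `0 < Q`, `1 ≤ m`, `0 ≤ δ`): if the pair radius after the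
pulse is at least `(m + 1)/Q` — `(m + 1)/Q ≤ x` — and the next rung's pair is `P' ≤ x² + δ`,
then `√P' ≤ x + (δQ/2)(log(m + 1) - log m)`: the ã-free slip `δ` costs `√P` only `δ/(2x) ≤
(δQ/2)/(m + 1)`. [derived: this file §270] -/
theorem sqrt_ledger_step {P' x δ Q m : ℝ} (hQ : 0 < Q) (hm : 1 ≤ m) (hδ : 0 ≤ δ)
    (hx : (m + 1) / Q ≤ x) (hP' : P' ≤ x ^ 2 + δ) :
    √P' ≤ x + δ * Q / 2 * (log (m + 1) - log m) := by
  have hmQ : 0 < (m + 1) / Q := div_pos (by linarith) hQ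
  have hx0 : 0 < x := lt_of_lt_of_le hmQ hx
  have h1 : √P' ≤ √(x ^ 2 + δ) := Real.sqrt_le_sqrt hP'
  have h2 := sqrt_sq_add_le_half hx0 hδ
  have h3 : δ / (2 * x) ≤ δ / (2 * ((m + 1) / Q)) :=
    div_le_div_of_nonneg_left hδ (by positivity) (by linarith)
  have h4 : δ / (2 * ((m + 1) / Q)) = (δ * Q / 2) / (m + 1) := by
    field_simp
  have h5 := log_succ_step hm (show 0 ≤ δ * Q / 2 by positivity)
  linarith [h1, h2, h3, h4, h5]

/-- §270 THE WINDOW IS MONOTONE: `0 ≤ u`, `0 ≤ c`, `1 ≤ n ≤ N` ⇒ `B + (n - 1)u + c log n ≤ B + (N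
- 1)u + c log N`. [folklore] -/
theorem pair_window_mono {B u c n N : ℝ} (hu : 0 ≤ u) (hc : 0 ≤ c) (hn : 1 ≤ n) (hnN : n ≤ N) :
    B + (n - 1) * u + c * log n ≤ B + (N - 1) * u + c * log N := by
  have h1 : (n - 1) * u ≤ (N - 1) * u := mul_le_mul_of_nonneg_right (by linarith) hu
  have h2 : log n ≤ log N := Real.log_le_log (by linarith) hnN
  have h3 := mul_le_mul_of_nonneg_left h2 hc
  linarith

/-- §270 THE CAP: `0 ≤ P`, `√P ≤ W ≤ V` ⇒ `P ≤ V²`. [folklore] -/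
theorem sqrt_pair_cap {P W V : ℝ} (hP : 0 ≤ P) (hW : √P ≤ W) (hV : W ≤ V) : P ≤ V ^ 2 := by
  have h1 : √P ^ 2 ≤ V ^ 2 := pow_le_pow_left₀ (Real.sqrt_nonneg _) (hW.trans hV) 2
  rwa [Real.sq_sqrt hP] at h1

/-! ## §271 The numbers of the √-ledger on the lattice -/

/-- §271 THE √-WINDOW IMPLIES `N - 1 ≤ K⁹` (`K ≥ 16`): from `y·(7/2 + k²/3 + 10⁻³)/K⁹ ≤ 0.15`.
[folklore] -/
theorem pair_window_coarse_sqrt (hK : 16 ≤ K) {k y : ℝ}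
    (hy : y * ((7 / 2 + k ^ 2 / 3 + 1 / 1000) / K ^ 9) ≤ 15 / 100) : y ≤ K ^ 9 := by
  have hK0 : (0 : ℝ) < K := by linarith
  have hK9 : (0 : ℝ) < K ^ 9 := by positivity
  by_cases hy0 : 0 ≤ y
  · have h1 : (1 : ℝ) / K ^ 9 ≤ (7 / 2 + k ^ 2 / 3 + 1 / 1000) / K ^ 9 :=
      div_le_div_of_nonneg_right (by nlinarith only [sq_nonneg k]) hK9.le
    have h2 := mul_le_mul_of_nonneg_left h1 hy0
    have h3 : y * (1 / K ^ 9) ≤ 15 / 100 := h2.trans hy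
    rw [mul_one_div, div_le_iff₀ hK9] at h3
    nlinarith only [h3, hK9]
  · linarith only [not_le.1 hy0, hK9]

/-- §271 **THE NUMBERS OF THE √-LEDGER** (`K ≥ 16`, `1 ≤ k ≤ K²`; part 86's ledgers `D = 7/K⁴`,
`ι = (2k + 3)/(5K⁹)`): (i) the log coefficient `δK⁹/2 ≤ (14k + 127)/(5K⁴)` for the ã-free slip
`δ = (2D + ι)ι + 6(D + ι + 3/K⁹)/K⁹`; (ii) the window arithmetic `(7/K⁴ + 0.1409)² + 10⁻⁴ +
(1.1 + k²/10)/K⁹ ≤ 1/50` (`√P₁ ≤ 7/K⁴`, first-rung slip `≤ 10⁻⁴`, `δ ≤ (1.1 + k²/10)/K⁹`).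
[folklore] -/
theorem pair_ledger_numerics (hK : 16 ≤ K) {k : ℝ} (hk1 : 1 ≤ k) (hkK : k ≤ K ^ 2) :
    ((2 * (7 / K ^ 4) + (2 * k + 3) / (5 * K ^ 9)) * ((2 * k + 3) / (5 * K ^ 9))
        + 6 * (7 / K ^ 4 + (2 * k + 3) / (5 * K ^ 9) + 3 / K ^ 9) / K ^ 9) * K ^ 9 / 2
      ≤ (14 * k + 127) / (5 * K ^ 4) ∧
    (7 / K ^ 4 + 1409 / 10000) ^ 2 + 1 / 10000 + (11 / 10 + k ^ 2 / 10) / K ^ 9 ≤ 1 / 50 := by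
  have hK0 : (0 : ℝ) < K := by linarith
  have hKne : K ≠ 0 := hK0.ne'
  have hk0 : 0 ≤ k := by linarith
  have hK2 : (256 : ℝ) ≤ K ^ 2 := by nlinarith
  have hK4p : (0 : ℝ) < K ^ 4 := by positivity
  have hK5p : (0 : ℝ) < K ^ 5 := by positivity
  have hK7p : (0 : ℝ) < K ^ 7 := by positivity
  have hK9p : (0 : ℝ) < K ^ 9 := by positivity
  have hK4 : (65536 : ℝ) ≤ K ^ 4 := by
    have := pow_le_pow_left₀ (by norm_num : (0 : ℝ) ≤ 16) hK 4; norm_num at this; exact this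
  have hK45 : 16 * K ^ 4 ≤ K ^ 5 := by
    calc 16 * K ^ 4 ≤ K * K ^ 4 := mul_le_mul_of_nonneg_right hK hK4p.le
      _ = K ^ 5 := by ring
  have hK47 : 4096 * K ^ 4 ≤ K ^ 7 := by
    have h3 : (4096 : ℝ) ≤ K ^ 3 := by
      have := pow_le_pow_left₀ (by norm_num : (0 : ℝ) ≤ 16) hK 3; norm_num at this; exact this
    calc 4096 * K ^ 4 ≤ K ^ 3 * K ^ 4 := mul_le_mul_of_nonneg_right h3 hK4p.le
      _ = K ^ 7 := by ring
  have hK49 : 1048576 * K ^ 4 ≤ K ^ 9 := by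
    have h5 : (1048576 : ℝ) ≤ K ^ 5 := by
      have := pow_le_pow_left₀ (by norm_num : (0 : ℝ) ≤ 16) hK 5; norm_num at this; exact this
    calc 1048576 * K ^ 4 ≤ K ^ 5 * K ^ 4 := mul_le_mul_of_nonneg_right h5 hK4p.le
      _ = K ^ 9 := by ring
  obtain ⟨ι, hι_def⟩ : ∃ ι : ℝ, ι = (2 * k + 3) / (5 * K ^ 9) := ⟨_, rfl⟩
  have hι0 : 0 ≤ ι := by rw [hι_def]; positivity
  have h23 : (2 * k + 3) / 5 ≤ K ^ 2 / 2 := by linarith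
  have hιK9 : ι * K ^ 9 = (2 * k + 3) / 5 := by rw [hι_def]; field_simp
  have hι7 : ι ≤ 1 / (2 * K ^ 7) := by
    have h1 : ι = ((2 * k + 3) / 5) / K ^ 9 := by rw [hι_def]; field_simp
    have h2 : ((2 * k + 3) / 5) / K ^ 9 ≤ (K ^ 2 / 2) / K ^ 9 :=
      div_le_div_of_nonneg_right h23 hK9p.le
    have h3 : (K ^ 2 / 2) / K ^ 9 = 1 / (2 * K ^ 7) := by field_simp
    linarith [h1, h2, h3]
  refine ⟨?_, ?_⟩
  · rw [← hι_def]
    have e : ((2 * (7 / K ^ 4) + ι) * ι + 6 * (7 / K ^ 4 + ι + 3 / K ^ 9) / K ^ 9) * K ^ 9 / 2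
        = ((28 * k + 42) / (5 * K ^ 4) + ι * ((2 * k + 3) / 5) + 42 / K ^ 4 + 6 * ι
          + 18 / K ^ 9) / 2 := by
      have e1 : ((2 * (7 / K ^ 4) + ι) * ι + 6 * (7 / K ^ 4 + ι + 3 / K ^ 9) / K ^ 9) * K ^ 9
          = (2 * (7 / K ^ 4) + ι) * (ι * K ^ 9) + 6 * (7 / K ^ 4 + ι + 3 / K ^ 9) := by
        field_simp
      rw [e1, hιK9]
      field_simp
      ring
    rw [e]
    have hprod : ι * ((2 * k + 3) / 5) ≤ 1 / (2 * K ^ 7) * (K ^ 2 / 2) :=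
      mul_le_mul hι7 h23 (by positivity) (by positivity)
    have hp' : 1 / (2 * K ^ 7) * (K ^ 2 / 2) = 1 / (4 * K ^ 5) := by field_simp; ring
    have h5 : 1 / (4 * K ^ 5) ≤ 1 / 64 * (1 / K ^ 4) := by
      rw [div_mul_div_comm, one_mul]
      exact div_le_div_of_nonneg_left (by norm_num) (by positivity) (by linarith [hK45])
    have h7 : 1 / (2 * K ^ 7) ≤ 1 / 8192 * (1 / K ^ 4) := by
      rw [div_mul_div_comm, one_mul]
      exact div_le_div_of_nonneg_left (by norm_num) (by positivity) (by linarith [hK47])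
    have h9 : 18 / K ^ 9 ≤ 18 / 1048576 * (1 / K ^ 4) := by
      rw [div_mul_div_comm, mul_one]
      exact div_le_div_of_nonneg_left (by norm_num) (by positivity) hK49
    have hw : 0 < 1 / K ^ 4 := by positivity
    have e2 : (14 * k + 127) / (5 * K ^ 4)
        = ((28 * k + 42) / (5 * K ^ 4) + 42 / K ^ 4 + (2 / 5) * (1 / K ^ 4)) / 2 := by
      field_simp; ring
    rw [e2]
    linarith [hprod, hp', h5, hι7, h7, h9, hw]
  · have h7 : 7 / K ^ 4 ≤ 7 / 65536 := div_le_div_of_nonneg_left (by norm_num) (by norm_num) hK4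
    have hsq : (7 / K ^ 4 + 1409 / 10000) ^ 2 ≤ (7 / 65536 + 1409 / 10000) ^ 2 :=
      pow_le_pow_left₀ (by positivity) (by linarith [h7]) 2
    have hk2 : k ^ 2 ≤ K ^ 4 := by
      have := pow_le_pow_left₀ hk0 hkK 2
      calc k ^ 2 ≤ (K ^ 2) ^ 2 := this
        _ = K ^ 4 := by ring
    have hd1 : (11 / 10 + k ^ 2 / 10) / K ^ 9 ≤ (11 / 10 + K ^ 4 / 10) / K ^ 9 :=
      div_le_div_of_nonneg_right (by linarith [hk2]) hK9p.le
    have hd2 : (11 / 10 + K ^ 4 / 10) / K ^ 9 = 11 / 10 * (1 / K ^ 9) + 1 / 10 * (1 / K ^ 5) := by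
      field_simp
    have hK9 : (68719476736 : ℝ) ≤ K ^ 9 := by
      have := pow_le_pow_left₀ (by norm_num : (0 : ℝ) ≤ 16) hK 9; norm_num at this; exact this
    have hK5 : (1048576 : ℝ) ≤ K ^ 5 := by
      have := pow_le_pow_left₀ (by norm_num : (0 : ℝ) ≤ 16) hK 5; norm_num at this; exact this
    have h9 : 1 / K ^ 9 ≤ 1 / 68719476736 :=
      div_le_div_of_nonneg_left (by norm_num) (by norm_num) hK9
    have h5 : 1 / K ^ 5 ≤ 1 / 1048576 :=
      div_le_div_of_nonneg_left (by norm_num) (by norm_num) hK5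
    have hnum : (7 / 65536 + 1409 / 10000 : ℝ) ^ 2 ≤ 19883 / 1000000 := by norm_num
    linarith [hsq, hnum, hd1, hd2, h9, h5]

end Summit.NavierStokesRegularity.FluidComputer.GateBudget

end
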